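import Literature.AlgebraicGeometry.Motives.AbelianVarietyProduct
import Literature.AlgebraicGeometry.Motives.AbelianVarietyProofs
import HarnessLib

/-!
# The dimension of a product of abelian varieties

`dim (A × B) = dim A + dim B` for abelian varieties over a field `K`
(`Literature.AlgebraicGeometry.Motives.AbelianVariety.prod` of `Motives/AbelianVarietyProduct`):
`A × B → A → Spec K` is the composite of a base change of `B → Spec K`, smooth of relative
dimension `dim B` (`smoothOfRelativeDimension_dim`, Görtz–Wedhorn I, Remark 16.54), with
`A → Spec K`, smooth of relative dimension `dim A`; so it is smooth of relative dimension
`dim B + dim A` (Mathlib: stability under base change and composition), and a non-empty scheme smooth of relative dimension `n` over a field has dimension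
`n` (`schemeDim_eq_of_smoothOfRelativeDimension`, Görtz–Wedhorn I, Lemma 6.26). This is the
dimension count used with Poincaré's complete reducibility theorem (Mumford, *Abelian Varieties*,
§19, Thm. 1: `dim Z = dim X - dim Y`). No definitions, no named facts.
-/

universe u

open CategoryTheory CategoryTheory.Limits AlgebraicGeometry

noncomputable section

namespace Literature.AlgebraicGeometry.Motives

namespace AbelianVariety

variable {K : Type u} [Field K] (A B : AbelianVariety K)

/-- The first projection `A × B → A` is smooth of relative dimension `dim B` (base change of
`B → Spec K`, which is smooth of relative dimension `dim B`; Görtz–Wedhorn I, Remark 16.54).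
[folklore] -/
theorem smoothOfRelativeDimension_fst :
    SmoothOfRelativeDimension B.dim (pullback.fst A.X.hom B.X.hom) := by
  haveI := B.smoothOfRelativeDimension_dim
  haveI := smoothOfRelativeDimension_isStableUnderBaseChange (n := B.dim)
  exact MorphismProperty.pullback_fst (P := @SmoothOfRelativeDimension B.dim) A.X.hom B.X.hom
    inferInstance

/-- `A × B → Spec K` is smooth of relative dimension `dim B + dim A` (composite of the first
projection with `A → Spec K`; Mathlib `smoothOfRelativeDimension_comp`). [folklore] -/
theorem smoothOfRelativeDimension_prod_hom :
    SmoothOfRelativeDimension (B.dim + A.dim) (A.prod B).X.hom := by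
  haveI := A.smoothOfRelativeDimension_dim
  haveI := smoothOfRelativeDimension_fst A B
  rw [prod_X_hom]
  exact smoothOfRelativeDimension_comp (n := B.dim) (m := A.dim)
    (f := pullback.fst A.X.hom B.X.hom) A.X.hom

/-- **`dim (A × B) = dim A + dim B`** for abelian varieties over a field: `A × B → Spec K` is
smooth of relative dimension `dim A + dim B`, and a non-empty scheme smooth of relative dimension
`n` over a field has dimension `n` (Görtz–Wedhorn I, Lemma 6.26; `schemeDim_eq_of_smoothOfRelativeDimension`).
[cite: GortzWedhorn2020, Lemma 6.26 and Remark 16.54] -/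
theorem dim_prod : (A.prod B).dim = A.dim + B.dim := by
  haveI := smoothOfRelativeDimension_prod_hom A B
  haveI := (A.prod B).irreducibleSpace_left
  have h := schemeDim_eq_of_smoothOfRelativeDimension (A.prod B).X.hom (B.dim + A.dim)
  change schemeDim (A.prod B).X.left = _
  rw [h, add_comm]

end AbelianVariety

end Literature.AlgebraicGeometry.Motives
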